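import Summits.ResolutionOfSingularities.ResolutionOfSingularities.Theorems.HomologicalConductorNoZenoUnionEntry
import Summits.ResolutionOfSingularities.ResolutionOfSingularities.Theorems.HomologicalConductorNoZenoThreadTower
import Summits.ResolutionOfSingularities.ResolutionOfSingularities.Theorems.HomologicalConductorNoZenoDim2RegularCentre
import Summits.ResolutionOfSingularities.ResolutionOfSingularities.Theorems.HomologicalConductorNoZenoIffKernel
import Literature.AlgebraicGeometry.Resolution.DominatedUnions
import Literature.AlgebraicGeometry.Resolution.PrimeDivisors
import HarnessLib

/-!
# Route `HomologicalConductor`, crux `NoZenoR` (stmt-ResolutionOfSingularities-19943; aside twin `NoZeno` 16483):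
# (TD) THE THREAD DICHOTOMY, preparations — the dominated chain of thread germs, the escape unit, independent residues

`[OURS · L W4.4]` Cell res-hironaka, crux chain W4.4; planner res-L0-w44-plan-1's entry cut of the (V26/v28) stub
`stub_HabExSw0` (CHAIN v19 §3.8, `Beta2Descent-r3_3.lean` §8 `Sig.ThreadDichotomy`), executed by res-L0-w44-stub-3.
Nothing here is a statement of the manuscript under review (Hironaka 2017); AI-written, weaker than expert review.

Along an infinite singular prime thread (thread data of the crux in transcendence degree `3`: stages
`T_m = tower O A m`, compatible primes `P_m ⊇ ca(T_m)`, an escape element `s ∈ T_{mₑ} ∩ 𝔪_O` off `P_{mₑ}`), the thread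
germs `D_(n+1) := (T_(n+1))_(P_(n+1))` (`Parasite.locPrime`; the planner's `Beta2Descent.germ O A P hP n`) form an
increasing DOMINATED chain of local subrings of `K`, each integrally closed in `K`; the escape element `s` is a unit of
every germ `D_(n+1)`, `n + 1 ≥ mₑ`, with residue TRANSCENDENTAL over `k`.  Let `D_∞ := ⋃ D_(n+1)`.

This file (1/2) carries the PREPARATIONS for the dichotomy (`…NoZenoThreadDichotomy.lean`, 2/2):
`subringDominates_locPrime_tower_succ/_of_le` (the chain of germs is dominated), `isIntegrallyClosedIn_locPrime_tower`
(germs are integrally closed in `K`), `aeval_escape_mem_not_mem` (the escape unit: `f(s) ∈ T_m ∖ P_m` for `f ≠ 0`),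
`valuation_eq_one_of_isUnit_subring`, `valuation_mvPolynomial_aeval_eq_one` (two independent residues `(t̄, s̄)` from
Lemma 7's polynomial form and the escape unit — the PRIME-DIVISOR input), `algebraicIndependent_residue_of_valuation`
(valuation form ⇒ `AlgebraicIndependent` of residues, the input of `isDiscreteValuationRing_of_primeDivisor`).

References: S. S. Abhyankar, Amer. J. Math. 78 (1956), Lemma 7 [`Abhyankar1956Valuations`] (tree theorem);
O. Zariski, P. Samuel, *Commutative Algebra* II, Ch. VI §14, Thm. 31 [`ZariskiSamuel1960`] (tree theorem).
-/

-- single-problem summit: the doubled namespace component `ResolutionOfSingularities` is forced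
set_option linter.dupNamespace false

noncomputable section

open IsLocalRing Polynomial
open Literature.AlgebraicGeometry.Resolution

namespace Summit.ResolutionOfSingularities.ResolutionOfSingularities.Theorems.NoZeno.Sandwiched

open Summit.ResolutionOfSingularities.ResolutionOfSingularities.Theses.HomologicalConductor
open Summit.ResolutionOfSingularities.ResolutionOfSingularities.Theorems.NoZeno.Birth
open Summit.ResolutionOfSingularities.ResolutionOfSingularities.Theorems.NoZeno.SandwichCluster.Parasite
  (locPrime mem_locPrime_iff mem_locPrime_of_mem inv_mem_locPrime_of_not_mem ne_zero_of_not_mem_ideal)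
open Summit.ResolutionOfSingularities.ResolutionOfSingularities.Theorems.NoZeno.SandwichCluster

variable {k K : Type} [Field k] [Field K] [Algebra k K]

section Chain

variable (O : ValuationSubring K) (A : Subalgebra k K)
  (hk : ∀ c : k, algebraMap k K c ∈ O) (hA : A.FG) (hfr : IsFractionRing ↥A K) (hAO : A.toSubring ≤ O.toSubring)
  (P : ∀ m : ℕ, Ideal ↥(tower O A m)) (hP : ∀ m, (P m).IsPrime)
  (hcompat : ∀ (m : ℕ) (x : K) (hx : x ∈ tower O A m) (hx' : x ∈ tower O A (m + 1)),
    (⟨x, hx'⟩ : ↥(tower O A (m + 1))) ∈ P (m + 1) ↔ (⟨x, hx⟩ : ↥(tower O A m)) ∈ P m)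

include hcompat in
/-- **The chain of thread germs is dominated**: `D_m ≤ D_(m+1)` and an element of `D_m` inverted in `D_(m+1)` is
inverted in `D_m` (`SubringDominates`). [this work] -/
theorem subringDominates_locPrime_tower_succ (m : ℕ) :
    SubringDominates (locPrime (tower O A m) (P m) (hP m)) (locPrime (tower O A (m + 1)) (P (m + 1)) (hP (m + 1))) := by
  refine ⟨locPrime_tower_subset_succ O A P hP hcompat m, fun x hx hxinv => ?_⟩
  by_cases hx0 : x = 0
  · rw [hx0, inv_zero]; exact Subring.zero_mem _
  have hu : IsUnit (Subring.inclusion (locPrime_tower_subset_succ O A P hP hcompat m) ⟨x, hx⟩) :=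
    (isUnit_subring_iff_inv_mem _).mpr ⟨hx0, hxinv⟩
  exact ((isUnit_subring_iff_inv_mem _).mp (isUnit_of_isUnit_inclusion_locPrime O A P hP hcompat m ⟨x, hx⟩ hu)).2

include hcompat in
/-- `D_m` is dominated by `D_(m')` for `m ≤ m'`. [this work] -/
theorem subringDominates_locPrime_tower_of_le {m m' : ℕ} (h : m ≤ m') :
    SubringDominates (locPrime (tower O A m) (P m) (hP m)) (locPrime (tower O A m') (P m') (hP m')) := by
  induction h with
  | refl => exact SubringDominates.refl _
  | step _ ih => exact ih.trans (subringDominates_locPrime_tower_succ O A P hP hcompat _)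

include hk hA hfr hAO in
/-- **The thread germs `D_(n+1)` are integrally closed in `K`**: the stage `T_(n+1)` is a normal domain
(`d2rc_isIntegrallyClosed_tower_succ`), so is its localisation (`Thread.isIntegrallyClosed_locPrime`), and `K` is its
field of fractions (`A ⊆ D_(n+1)`, `Frac A = K`). [this work] -/
theorem isIntegrallyClosedIn_locPrime_tower (n : ℕ) :
    IsIntegrallyClosedIn ↥(locPrime (tower O A (n + 1)) (P (n + 1)) (hP (n + 1))) K := by
  haveI := hfr
  haveI := hP (n + 1)
  haveI : IsIntegrallyClosed ↥(tower O A (n + 1)) := d2rc_isIntegrallyClosed_tower_succ O A hk hA hfr hAO n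
  haveI : IsIntegrallyClosed ↥(locPrime (tower O A (n + 1)) (P (n + 1)) (hP (n + 1))) :=
    Thread.isIntegrallyClosed_locPrime (tower O A (n + 1)) (P (n + 1)) (hP (n + 1))
  obtain ⟨hAT, -, -⟩ := tn_tower_invariant O A hk hA hfr hAO (n + 1)
  have hAD : ∀ a : ↥A, (a : K) ∈ locPrime (tower O A (n + 1)) (P (n + 1)) (hP (n + 1)) :=
    fun a => mem_locPrime_of_mem _ _ _ (hAT a.2)
  haveI : IsFractionRing ↥(locPrime (tower O A (n + 1)) (P (n + 1)) (hP (n + 1))) K := by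
    refine IsFractionRing.of_field _ K fun z => ?_
    obtain ⟨a, b, -, hz⟩ := IsFractionRing.div_surjective (A := ↥A) z
    exact ⟨⟨a, hAD a⟩, ⟨b, hAD b⟩, hz.symm⟩
  exact (isIntegrallyClosed_iff_isIntegrallyClosedIn K).mp ‹_›

end Chain

/-! ## The escape element is a unit of the germs with transcendental residue -/

section Escape

variable (O : ValuationSubring K) (A : Subalgebra k K)
  (hk : ∀ c : k, algebraMap k K c ∈ O) (hAO : A.toSubring ≤ O.toSubring)

include hk hAO in
/-- **The escape element is residually transcendental**: for `s ∈ T := tower O A m` of positive `O`-value and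
`f ∈ k[X]` non-zero, `f(s) ∈ T` and `f(s) ∉ P` for every PROPER ideal `P` of `T` not containing `s` which is prime.
Proof by induction on the degree: if `f(0) ≠ 0` then `f(s) = s·g(s) + f(0)` is an `O`-unit, hence a `T`-unit (stages
invert their `O`-units, `inv_mem_tower_of_inv_mem`), so not in `P`; if `f(0) = 0` then `f = X·g` and `f(s) = s·g(s) ∈ P`
forces `g(s) ∈ P`. [this work] -/
theorem aeval_escape_mem_not_mem (m : ℕ) (P : Ideal ↥(tower O A m)) [P.IsPrime] {s : K}
    (hs : s ∈ tower O A m) (hvs : O.valuation s < 1) (hsP : (⟨s, hs⟩ : ↥(tower O A m)) ∉ P) :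
    ∀ f : k[X], f ≠ 0 → ∃ hf : aeval s f ∈ tower O A m, (⟨aeval s f, hf⟩ : ↥(tower O A m)) ∉ P := by
  have hTO : ∀ x : K, x ∈ tower O A m → x ∈ O := mem_valuationSubring_of_mem_tower O hk hAO m
  have hmem : ∀ f : k[X], aeval s f ∈ tower O A m := fun f => by
    have : aeval s f = ((aeval (⟨s, hs⟩ : ↥(tower O A m)) f : ↥(tower O A m)) : K) := by
      rw [← Subalgebra.aeval_coe]
    rw [this]; exact Subtype.coe_prop _
  intro f
  induction hdeg : f.natDegree using Nat.strong_induction_on generalizing f with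
  | _ d ih =>
    intro hf0
    refine ⟨hmem f, ?_⟩
    by_cases hc : f.coeff 0 = 0
    · -- `f = X * divX f`
      have hfX : f = X * f.divX := by
        conv_lhs => rw [← X_mul_divX_add f, hc, map_zero, add_zero]
      have hg0 : f.divX ≠ 0 := by
        intro h; apply hf0; rw [hfX, h, mul_zero]
      have hdeg' : f.divX.natDegree < d := by
        rw [← hdeg, natDegree_divX_eq_natDegree_tsub_one]
        have : 0 < f.natDegree := by
          by_contra h0
          push Not at h0
          have h00 : f.natDegree = 0 := Nat.le_zero.mp h0
          apply hf0
          rw [eq_C_of_natDegree_eq_zero h00, hc, map_zero]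
        omega
      obtain ⟨hg, hgP⟩ := ih _ hdeg' (f := f.divX) rfl hg0
      intro hfP
      have hprod : (⟨aeval s f, hmem f⟩ : ↥(tower O A m)) = ⟨s, hs⟩ * ⟨aeval s f.divX, hg⟩ := by
        refine Subtype.ext ?_
        change aeval s f = s * aeval s f.divX
        conv_lhs => rw [hfX]
        rw [map_mul, aeval_X]
      rw [hprod] at hfP
      rcases ‹P.IsPrime›.mem_or_mem hfP with h | h
      · exact hsP h
      · exact hgP h
    · -- `f(s) = s * g(s) + f(0)` is an `O`-unit, hence a unit of the stage
      intro hfP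
      set c : K := algebraMap k K (f.coeff 0) with hc'
      have hcunit : O.valuation c = 1 := by
        have hcO : c ∈ O := hk _
        have hciO : c⁻¹ ∈ O := by rw [hc', ← map_inv₀]; exact hk _
        have hc0 : c ≠ 0 := by rw [hc']; exact (_root_.map_ne_zero (algebraMap k K)).mpr hc
        exact le_antisymm ((O.valuation_le_one_iff _).mpr hcO)
          (by rw [← inv_inv c, map_inv₀, one_le_inv₀ ((Valuation.pos_iff _).mpr (inv_ne_zero hc0))]
              exact (O.valuation_le_one_iff _).mpr hciO)
      have hsplit : aeval s f = s * aeval s f.divX + c := by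
        conv_lhs => rw [← X_mul_divX_add f]
        rw [map_add, map_mul, aeval_X, aeval_C]
      have hlt : O.valuation (s * aeval s f.divX) < 1 := by
        rw [map_mul]
        calc O.valuation s * O.valuation (aeval s f.divX)
            ≤ O.valuation s * 1 := by
              gcongr
              exact (O.valuation_le_one_iff _).mpr (hTO _ (hmem _))
          _ < 1 := by rw [mul_one]; exact hvs
      have hval : O.valuation (aeval s f) = 1 := by
        have hlt' : O.valuation (s * aeval s f.divX) < O.valuation c := by rw [hcunit]; exact hlt
        rw [hsplit, Valuation.map_add_eq_of_lt_right _ hlt', hcunit]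
      -- an `O`-unit of the stage is a unit of the stage
      have h0 : aeval s f ≠ 0 := fun h => by rw [h, map_zero] at hval; exact zero_ne_one hval
      have hinvO : (aeval s f)⁻¹ ∈ O := by
        rw [← O.valuation_le_one_iff, map_inv₀, hval, inv_one]
      have hinvT : (aeval s f)⁻¹ ∈ tower O A m := by
        obtain ⟨B, hBO, hTB⟩ := exists_tower_eq_loc O A hk hAO m
        have h1 : aeval s f ∈ SyzygyFlattening.locAt O B := by
          rw [← loc_eq_locAt, ← hTB]; exact hmem f
        have h2 := SyzygyFlattening.inv_mem_locAt O B hBO h1 hval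
        rw [← loc_eq_locAt, ← hTB] at h2
        exact h2
      have hunit : IsUnit (⟨aeval s f, hmem f⟩ : ↥(tower O A m)) :=
        (isUnit_subring_iff_inv_mem (R := (tower O A m).toSubring) ⟨aeval s f, hmem f⟩).mpr ⟨h0, hinvT⟩
      exact ‹P.IsPrime›.ne_top (P.eq_top_of_isUnit_mem hfP hunit)

end Escape


/-! ## Units of a containing valuation ring; two independent residues from Lemma 7's polynomial form -/

section Residues

/-- An element of a subring `R ≤ W` of the valuation ring `W` that is a UNIT of `R` has `W`-value `1`. [folklore] -/
theorem valuation_eq_one_of_isUnit_subring (W : ValuationSubring K) (R : Subring K) (hRW : R ≤ W.toSubring)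
    (x : ↥R) (hx : IsUnit x) : W.valuation (x : K) = 1 := by
  obtain ⟨hx0, hxinv⟩ := (isUnit_subring_iff_inv_mem x).mp hx
  exact (W.valuation_eq_one_iff ⟨(x : K), hRW x.2⟩).mp (isUnit_of_inv_mem W (hRW x.2) (hRW hxinv) hx0)

/-- **Two independent residues from Abhyankar's Lemma 7.**  Let `R ≤ W` be a subring of the valuation ring `W` with a
`k`-algebra structure compatible with `K`, `t ∈ W` residually transcendental over `κ(R)` in the polynomial form delivered
by `DominatedUnions.exists_valuationSubring_dominates_of_chain'` (a polynomial over `R` of `W`-value `< 1` at `t` has no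
unit coefficient), and `s ∈ R` with `g(s)` a UNIT of `R` for every non-zero `g ∈ k[X]` (residue of `s` transcendental
over `k`).  Then every non-zero `f ∈ k[X₀, X₁]` has `W`-value `1` at `(t, s)`: the residues of `t` and `s` are
algebraically independent over `k`.  (Write `f` as a polynomial in `X₀` with coefficients `g_j(X₁)`,
`MvPolynomial.finSuccEquiv`; its value at `t` has coefficients `g_j(s)`, units unless `g_j = 0`.) [this work] -/
theorem valuation_mvPolynomial_aeval_eq_one (W : ValuationSubring K) (R : Subring K) (hRW : R ≤ W.toSubring)
    [Algebra k ↥R] [IsScalarTower k ↥R K] {t : K} (htW : t ∈ W)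
    (hpoly : ∀ p : (↥R)[X], W.valuation (aeval t p) < 1 → ∀ j, ¬ IsUnit (p.coeff j))
    (s : ↥R) (hs : ∀ g : k[X], g ≠ 0 → IsUnit (aeval s g)) :
    ∀ f : MvPolynomial (Fin 2) k, f ≠ 0 → W.valuation (MvPolynomial.aeval ![t, (s : K)] f) = 1 := by
  intro f hf0
  -- the coefficient map `g ↦ g(s) ∈ R` and the lift `P̃ ∈ R[X]` of `f`
  let ψ : MvPolynomial (Fin 1) k →ₐ[k] ↥R := MvPolynomial.aeval fun _ => s
  let Φ : MvPolynomial (Fin 2) k →ₐ[k] K :=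
    ((Polynomial.aeval t : (↥R)[X] →ₐ[↥R] K).restrictScalars k).comp
      ((Polynomial.mapAlgHom ψ).comp (MvPolynomial.finSuccEquiv k 1).toAlgHom)
  have hΦ : Φ = MvPolynomial.aeval ![t, (s : K)] := by
    refine MvPolynomial.algHom_ext fun i => ?_
    fin_cases i
    · change Polynomial.aeval t (Polynomial.map (ψ : MvPolynomial (Fin 1) k →+* ↥R)
        (MvPolynomial.finSuccEquiv k 1 (MvPolynomial.X 0))) = _
      rw [MvPolynomial.finSuccEquiv_X_zero, Polynomial.map_X, Polynomial.aeval_X, MvPolynomial.aeval_X]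
      rfl
    · change Polynomial.aeval t (Polynomial.map (ψ : MvPolynomial (Fin 1) k →+* ↥R)
        (MvPolynomial.finSuccEquiv k 1 (MvPolynomial.X (1 : Fin 2)))) = _
      have h1 : (1 : Fin 2) = (0 : Fin 1).succ := rfl
      rw [h1, MvPolynomial.finSuccEquiv_X_succ, Polynomial.map_C, Polynomial.aeval_C, MvPolynomial.aeval_X]
      change ((ψ (MvPolynomial.X 0) : ↥R) : K) = _
      rw [MvPolynomial.aeval_X]
      rfl
  set Pt : (↥R)[X] := Polynomial.map (ψ : MvPolynomial (Fin 1) k →+* ↥R) (MvPolynomial.finSuccEquiv k 1 f) with hPt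
  have hval_eq : Polynomial.aeval t Pt = MvPolynomial.aeval ![t, (s : K)] f := by
    rw [← hΦ]; rfl
  -- the value lies in `W`
  have hmemW : MvPolynomial.aeval ![t, (s : K)] f ∈ W := by
    let W' : Subalgebra k K :=
      { W.toSubring with
        algebraMap_mem' := fun c => hRW (by
          have : ((algebraMap k ↥R c : ↥R) : K) = algebraMap k K c :=
            (IsScalarTower.algebraMap_apply k (↥R) K c).symm
          rw [← this]; exact Subtype.coe_prop _) }
    have hy : ∀ i, (![t, (s : K)] : Fin 2 → K) i ∈ W' := by
      intro i; fin_cases i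
      · exact htW
      · exact hRW s.2
    have := Subalgebra.mvPolynomial_aeval_coe W' (fun i => ⟨_, hy i⟩) f
    have hfun : (fun i => ((⟨(![t, (s : K)] : Fin 2 → K) i, hy i⟩ : W') : K)) = ![t, (s : K)] :=
      funext fun _ => rfl
    rw [hfun] at this
    change MvPolynomial.aeval ![t, (s : K)] f ∈ W'
    rw [this]
    exact Subtype.coe_prop _
  refine le_antisymm ((W.valuation_le_one_iff _).mpr hmemW) (not_lt.mp fun hlt => ?_)
  -- all coefficients `g_j(s)` of `Pt` are non-units, hence all `g_j = 0`, hence `f = 0`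
  rw [← hval_eq] at hlt
  have hcoef := hpoly Pt hlt
  have hunit : ∀ g : MvPolynomial (Fin 1) k, g ≠ 0 → IsUnit (ψ g) := by
    intro g hg
    have hg' : MvPolynomial.uniqueAlgEquiv k (Fin 1) g ≠ 0 :=
      fun h => hg ((MvPolynomial.uniqueAlgEquiv k (Fin 1)).injective (by rw [h, map_zero]))
    have hψ : ψ g = Polynomial.aeval s (MvPolynomial.uniqueAlgEquiv k (Fin 1) g) := by
      have : ψ = (Polynomial.aeval s : k[X] →ₐ[k] ↥R).comp (MvPolynomial.uniqueAlgEquiv k (Fin 1)).toAlgHom := by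
        refine MvPolynomial.algHom_ext fun i => ?_
        obtain rfl : i = default := Subsingleton.elim _ _
        change MvPolynomial.aeval (fun _ => s) (MvPolynomial.X default) =
          Polynomial.aeval s (MvPolynomial.uniqueAlgEquiv k (Fin 1) (MvPolynomial.X default))
        rw [MvPolynomial.aeval_X]
        have hX : MvPolynomial.uniqueAlgEquiv k (Fin 1) (MvPolynomial.X default) = Polynomial.X := by
          rw [MvPolynomial.uniqueAlgEquiv_apply, MvPolynomial.eval₂_X]
        rw [hX, Polynomial.aeval_X]
      rw [this]; rfl
    rw [hψ]
    exact hs _ hg'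
  have hcoef0 : ∀ j, (MvPolynomial.finSuccEquiv k 1 f).coeff j = 0 := by
    intro j
    by_contra hne
    exact hcoef j (by rw [hPt, Polynomial.coeff_map]; exact hunit _ hne)
  have hf1 : MvPolynomial.finSuccEquiv k 1 f = 0 :=
    Polynomial.ext fun j => by rw [hcoef0 j, Polynomial.coeff_zero]
  exact hf0 ((MvPolynomial.finSuccEquiv k 1).injective (by rw [hf1, map_zero]))

/-- The valuation form of residual independence gives ALGEBRAIC INDEPENDENCE of the residues. [this work] -/
theorem algebraicIndependent_residue_of_valuation (V : ValuationSubring K) (hkV : ∀ c : k, algebraMap k K c ∈ V)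
    {n : ℕ} (y : Fin n → K) (hyV : ∀ i, y i ∈ V)
    (hval : ∀ f : MvPolynomial (Fin n) k, f ≠ 0 → V.valuation (MvPolynomial.aeval y f) = 1) :
    letI := algebraOfMem k V hkV
    AlgebraicIndependent k fun i => residue V ⟨y i, hyV i⟩ := by
  letI := algebraOfMem k V hkV
  haveI := isScalarTower_algebraOfMem k V hkV
  rw [algebraicIndependent_iff]
  intro f hf
  by_contra hf0
  let y' : Fin n → ↥V := fun i => ⟨y i, hyV i⟩
  let ρ : ↥V →ₐ[k] ResidueField ↥V := IsScalarTower.toAlgHom k (↥V) (ResidueField ↥V)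
  have h1 : MvPolynomial.aeval (fun i => residue V (y' i)) f = ρ (MvPolynomial.aeval y' f) :=
    (MvPolynomial.comp_aeval_apply y' ρ f).symm
  have h2 : residue V (MvPolynomial.aeval y' f) = 0 := by
    have := hf
    rw [h1] at this
    exact this
  rw [residue_eq_zero_iff, ValuationSubring.valuation_lt_one_iff] at h2
  have h3 : ((MvPolynomial.aeval y' f : ↥V) : K) = MvPolynomial.aeval y f :=
    MvPolynomial.comp_aeval_apply y' (IsScalarTower.toAlgHom k (↥V) K) f
  rw [h3, hval f hf0] at h2
  exact lt_irrefl _ h2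

end Residues
end Summit.ResolutionOfSingularities.ResolutionOfSingularities.Theorems.NoZeno.Sandwiched

end
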